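import Mathlib
import HarnessLib
import Summits.Ventures.LatticeQCDFlow.Scaling.AutoregressiveGaugeHeatBathClosingMapFloor

/-!
# LatticeQCDFlow / Scaling — the volume law, lower half, with every uncovered plaquette paying: for EVERY
# optimal ranked structure of `(ℤ/L)^d` the exact heat-bath sampler's acceptance mass is
# `≤ (∏_{a∈B} θ_a)·M^{k_min}/F_R(U)`, one factor `θ_a = c_{n_a+1}/(c·M^{n_a}) ≤ 1` per covered closer,
# `Σ_a n_a = k_min(d, L)`

HONEST FRAMING: exact (Metropolis-corrected) sampling algorithms for lattice gauge theory;
figures of merit are autocorrelation/cost numbers at stated couplings and volumes; no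
continuum-physics claim.

Venture `LatticeQCDFlow` (cell pub-lqcd), topic `Scaling`, FANOUT row 30 (lean-1, GEN-27) — OUR WORK on
THEORY-2.md §4 row C5.  Packaging of `AutoregressiveGaugeHeatBathClosingMapFloor` for the writer, in the
shape of GEN-26's `AutoregressiveGaugeHeatBathVolumeLaw.exists_optimal_volumeFloor` but for EVERY optimal
structure and with the sharper constant:

* **`optimal_totalClosingMap_volumeFloor`** — `L ≥ 2`; `w` continuous, `0 < m ≤ w ≤ M`; `(B, t, rank)` ranked
  and OPTIMAL (`#Bᶜ = k_min(d, L) = (d−1)(d−2)/2·L^d + (d−1)`).  There are a refined rank `rank'` and a TOTAL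
  closing map `u : Bᶜ → B` (`t (u p')` a link of `p'`; `u p'` beats every other covered plaquette whose top link
  lies on `p'`), whose fibres PARTITION `Bᶜ` (`Σ_{a∈B} n_a = k_min`, `n_a = #u⁻¹(a)`), such that for the target
  `π`, the block proposal `q` and the exact sampler: (a) the acceptance mass from every `U` is
  `≤ η·M^{k_min}/F_R(U)` with `η = ∏_{a∈B} c_{n_a+1}/(c·M^{n_a})` (`c_n = ∫ wⁿ dHaar`); (b) every event
  `A ⊆ {F_R > θM^{k_min}}` of positive probability has `τ_int(1_A − π(A)) ≥ 1/(π(A) + η/θ) − 1/2`.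
  Every factor of `η` is `≤ 1` and `< 1` when `n_a ≥ 1` and `w` is not constant
  (`AutoregressiveGaugeHeatBathClosingMapFloor.ratio_le_one` ∕ `ratio_lt_one`); GEN-26 guaranteed only
  `s ≥ k_min/(2d−3)` factors `M₂/M`;
* **`prod_ratio_le_twoWeight_pow`** — `η ≤ (c_2/(c·M))^{#u(Bᶜ)}`: the closing-map constant is never weaker than
  GEN-26's closing-section constant with the Cauchy–Schwarz `M₂ = c_2/c` and the same closers.

No `def`, no `sorry`, nothing cited as a fact beyond the tree.
-/

noncomputable section

namespace Summit.Ventures.LatticeQCDFlow.Theory2.Autoregressive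

open MeasureTheory ProbabilityTheory Function Finset
open Summit.Ventures.LatticeQCDFlow.Exactness Summit.Ventures.LatticeQCDFlow.Scoring
open Literature.MathematicalPhysics.QuantumFieldTheory Literature.MathematicalPhysics.QuantumLattice
open scoped ENNReal

variable {d L : ℕ} [NeZero L] {G : Type*} [Group G] [TopologicalSpace G] [IsTopologicalGroup G]
  [CompactSpace G] [SecondCountableTopology G] [MeasurableSpace G] [BorelSpace G]

/-- **THE VOLUME LAW, LOWER HALF, EVERY OPTIMAL STRUCTURE, EVERY UNCOVERED PLAQUETTE PAYING.**  See the module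
docstring. [ours] -/
theorem optimal_totalClosingMap_volumeFloor (hL : 2 ≤ L) {w : G → ℝ} (hw : Continuous w) {m M : ℝ}
    (hm0 : 0 < m) (hm : ∀ g, m ≤ w g) (hM : ∀ g, w g ≤ M)
    (B : Finset (Plaquette d L)) (t : Plaquette d L → Edge d L)
    (ht : ∀ p ∈ B, t p ∈ ({(p.1, p.2.1.1), (p.1.shift p.2.1.1, p.2.1.2),
        (p.1.shift p.2.1.2, p.2.1.1), (p.1, p.2.1.2)} : Finset (Edge d L)))
    (rank : Plaquette d L → ℕ)
    (hrank : ∀ p ∈ B, ∀ p' ∈ B, p ≠ p' → t p ∈ ({(p'.1, p'.2.1.1), (p'.1.shift p'.2.1.1, p'.2.1.2),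
        (p'.1.shift p'.2.1.2, p'.2.1.1), (p'.1, p'.2.1.2)} : Finset (Edge d L)) → rank p < rank p')
    (hopt : (Finset.univ \ B).card = (d - 1) * (d - 2) / 2 * L ^ d + (d - 1)) :
    ∃ (rank' : Plaquette d L → ℕ) (u : Plaquette d L → Plaquette d L),
      (∀ p ∈ B, ∀ p' ∈ B, p ≠ p' → t p ∈ ({(p'.1, p'.2.1.1), (p'.1.shift p'.2.1.1, p'.2.1.2),
        (p'.1.shift p'.2.1.2, p'.2.1.1), (p'.1, p'.2.1.2)} : Finset (Edge d L)) → rank' p < rank' p') ∧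
      (∀ p' ∈ Finset.univ \ B, u p' ∈ B) ∧
      (∀ p' ∈ Finset.univ \ B, t (u p') ∈ ({(p'.1, p'.2.1.1), (p'.1.shift p'.2.1.1, p'.2.1.2),
        (p'.1.shift p'.2.1.2, p'.2.1.1), (p'.1, p'.2.1.2)} : Finset (Edge d L))) ∧
      (∀ p' ∈ Finset.univ \ B, ∀ p ∈ B, p ≠ u p' → t p ∈ ({(p'.1, p'.2.1.1), (p'.1.shift p'.2.1.1, p'.2.1.2),
        (p'.1.shift p'.2.1.2, p'.2.1.1), (p'.1, p'.2.1.2)} : Finset (Edge d L)) → rank' p < rank' (u p')) ∧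
      (∑ a ∈ B, ((Finset.univ \ B).filter (fun p' => u p' = a)).card =
        (d - 1) * (d - 2) / 2 * L ^ d + (d - 1)) ∧
      ∀ (π q : Measure (GaugeConfig d L G)) [IsProbabilityMeasure π] [IsProbabilityMeasure q],
        π = ((Measure.pi fun _ : Edge d L => haarProbability G).withDensity fun U =>
          ENNReal.ofReal ((∏ p : Plaquette d L, w (plaquetteHolonomy U p.1 p.2.1.1 p.2.1.2)) /
            ∫ V, ∏ p : Plaquette d L, w (plaquetteHolonomy V p.1 p.2.1.1 p.2.1.2)
              ∂(Measure.pi fun _ : Edge d L => haarProbability G))) →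
        q = ((Measure.pi fun _ : Edge d L => haarProbability G).withDensity fun U =>
          ENNReal.ofReal ((∏ p ∈ B, w (plaquetteHolonomy U p.1 p.2.1.1 p.2.1.2)) /
            ∫ V, ∏ p ∈ B, w (plaquetteHolonomy V p.1 p.2.1.1 p.2.1.2)
              ∂(Measure.pi fun _ : Edge d L => haarProbability G))) →
        (∀ U : GaugeConfig d L G,
          (imhAcceptMass q (fun U =>
            ((∫ V, ∏ p : Plaquette d L, w (plaquetteHolonomy V p.1 p.2.1.1 p.2.1.2)
                ∂(Measure.pi fun _ : Edge d L => haarProbability G)) /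
              ((∫ V, ∏ p ∈ B, w (plaquetteHolonomy V p.1 p.2.1.1 p.2.1.2)
                ∂(Measure.pi fun _ : Edge d L => haarProbability G)) *
                ∏ p ∈ Finset.univ \ B, w (plaquetteHolonomy U p.1 p.2.1.1 p.2.1.2)))⁻¹) U).toReal ≤
            (∏ a ∈ B, (∫ h, w h ^ (((Finset.univ \ B).filter (fun p' => u p' = a)).card + 1) ∂(haarProbability G)) /
              ((∫ g, w g ∂(haarProbability G)) * M ^ ((Finset.univ \ B).filter (fun p' => u p' = a)).card)) * (M ^ (Finset.univ \ B).card /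
              ∏ p ∈ Finset.univ \ B, w (plaquetteHolonomy U p.1 p.2.1.1 p.2.1.2))) ∧
        ∀ θ : ℝ, 0 < θ → ∀ A : Set (GaugeConfig d L G), MeasurableSet A →
          (∀ U ∈ A, θ * M ^ (Finset.univ \ B).card <
            ∏ p ∈ Finset.univ \ B, w (plaquetteHolonomy U p.1 p.2.1.1 p.2.1.2)) → 0 < π.real A →
          1 / (π.real A + (∏ a ∈ B, (∫ h, w h ^ (((Finset.univ \ B).filter (fun p' => u p' = a)).card + 1) ∂(haarProbability G)) /
              ((∫ g, w g ∂(haarProbability G)) * M ^ ((Finset.univ \ B).filter (fun p' => u p' = a)).card)) / θ) - 1 / 2 ≤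
            tauInt (fun n => autocov (indepMH q fun U =>
              ((∫ V, ∏ p : Plaquette d L, w (plaquetteHolonomy V p.1 p.2.1.1 p.2.1.2)
                  ∂(Measure.pi fun _ : Edge d L => haarProbability G)) /
                ((∫ V, ∏ p ∈ B, w (plaquetteHolonomy V p.1 p.2.1.1 p.2.1.2)
                  ∂(Measure.pi fun _ : Edge d L => haarProbability G)) *
                  ∏ p ∈ Finset.univ \ B, w (plaquetteHolonomy U p.1 p.2.1.1 p.2.1.2)))⁻¹) π
                (fun U => A.indicator (fun _ => (1 : ℝ)) U - π.real A) n /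
              autocov (indepMH q fun U =>
              ((∫ V, ∏ p : Plaquette d L, w (plaquetteHolonomy V p.1 p.2.1.1 p.2.1.2)
                  ∂(Measure.pi fun _ : Edge d L => haarProbability G)) /
                ((∫ V, ∏ p ∈ B, w (plaquetteHolonomy V p.1 p.2.1.1 p.2.1.2)
                  ∂(Measure.pi fun _ : Edge d L => haarProbability G)) *
                  ∏ p ∈ Finset.univ \ B, w (plaquetteHolonomy U p.1 p.2.1.1 p.2.1.2)))⁻¹) π
                (fun U => A.indicator (fun _ => (1 : ℝ)) U - π.real A) 0) := by
  classical
  obtain ⟨rank', u, hrank', huB, hut, humax⟩ := exists_closingMap_of_optimal hL B t ht rank hrank hopt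
  refine ⟨rank', u, hrank', huB, hut, humax, ?_, ?_⟩
  · rw [← hopt]
    exact (Finset.card_eq_sum_card_fiberwise fun p' hp' => huB p' hp').symm
  · intro π q _ _ hπ hq
    exact totalClosingMap_volumeFloor (G := G) hL hw hm0 hm hM B t ht rank' hrank' u huB hut humax π q hπ hq

/-! ## The new constant dominates GEN-26's -/

omit [NeZero L] [SecondCountableTopology G] in
/-- **`η ≤ θ_1^{#closers}`**: for any map `u` on `Bᶜ` landing in `B`, the product `η = ∏_{a∈B} c_{n_a+1}/(c·M^{n_a})`
(`n_a = #u⁻¹(a)`) is at most `(c_2/(c·M))^{#u(Bᶜ)}` — closers with empty fibre contribute `c_1/c = 1`, every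
other factor is `≤ θ_1 = c_2/(c·M)` (`PlaquetteManyWeightConstant.integral_pow_ratio_le_two`).  With `u` the
maximal-rank closer of an optimal structure, `u(Bᶜ)` is the closer set of GEN-26's closing-section
construction (`TorusClosingSection.exists_closingSection`), and every two-plaquette constant `M₂` admissible
there has `c_2/c ≤ M₂` (take `a = b = 1` in its hypothesis), so the closing-map floor is never weaker than the
closing-section floor. [ours] -/
theorem prod_ratio_le_twoWeight_pow [NeZero L] {w : G → ℝ} (hw : Continuous w) (hw0 : ∀ g, 0 < w g) {M : ℝ}
    (hM : ∀ g, w g ≤ M) (B : Finset (Plaquette d L)) (u : Plaquette d L → Plaquette d L)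
    (huB : ∀ p' ∈ Finset.univ \ B, u p' ∈ B) :
    (∏ a ∈ B, (∫ h, w h ^ (((Finset.univ \ B).filter (fun p' => u p' = a)).card + 1) ∂(haarProbability G)) /
        ((∫ g, w g ∂(haarProbability G)) * M ^ ((Finset.univ \ B).filter (fun p' => u p' = a)).card)) ≤
      ((∫ h, w h ^ 2 ∂(haarProbability G)) / ((∫ g, w g ∂(haarProbability G)) * M ^ 1)) ^
        ((Finset.univ \ B).image u).card := by
  classical
  have hc : 0 < ∫ g, w g ∂(haarProbability G) := haarProbability_integral_pos_of_continuous_pos hw hw0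
  have hMpos : 0 < M := (hw0 1).trans_le (hM 1)
  set I := (Finset.univ \ B).image u with hI
  have hIB : I ⊆ B := fun a ha => by
    obtain ⟨p', hp', rfl⟩ := Finset.mem_image.1 ha
    exact huB p' hp'
  set f : Plaquette d L → ℝ := fun a =>
    (∫ h, w h ^ (((Finset.univ \ B).filter (fun p' => u p' = a)).card + 1) ∂(haarProbability G)) /
      ((∫ g, w g ∂(haarProbability G)) * M ^ ((Finset.univ \ B).filter (fun p' => u p' = a)).card) with hf
  have hf0 : ∀ a, 0 ≤ f a := fun a =>
    div_nonneg (integral_nonneg fun h => pow_nonneg (hw0 h).le _) (mul_nonneg hc.le (pow_nonneg hMpos.le _))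
  -- closers outside the image have empty fibre and factor `1`
  have hone : ∀ a ∈ B \ I, f a = 1 := by
    intro a ha
    have hempty : (Finset.univ \ B).filter (fun p' => u p' = a) = ∅ := by
      rw [Finset.filter_eq_empty_iff]
      intro p' hp' h
      exact (Finset.mem_sdiff.1 ha).2 (Finset.mem_image.2 ⟨p', hp', h⟩)
    rw [hf]
    simp only [hempty, Finset.card_empty, zero_add, pow_one, pow_zero, mul_one]
    exact div_self hc.ne'
  -- the others are `≤ θ_1`
  have hle : ∀ a ∈ I, f a ≤ (∫ h, w h ^ 2 ∂(haarProbability G)) / ((∫ g, w g ∂(haarProbability G)) * M ^ 1) := by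
    intro a ha
    obtain ⟨p', hp', hup⟩ := Finset.mem_image.1 ha
    have hpos : 0 < ((Finset.univ \ B).filter (fun p'' => u p'' = a)).card :=
      Finset.card_pos.2 ⟨p', Finset.mem_filter.2 ⟨hp', hup⟩⟩
    obtain ⟨n, hn⟩ : ∃ n, ((Finset.univ \ B).filter (fun p'' => u p'' = a)).card = n + 1 :=
      ⟨_, (Nat.succ_pred_eq_of_pos hpos).symm⟩
    rw [hf]
    simp only [hn]
    exact integral_pow_ratio_le_two hw hw0 hM n
  calc ∏ a ∈ B, f a = (∏ a ∈ B \ I, f a) * ∏ a ∈ I, f a := (Finset.prod_sdiff hIB).symm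
    _ = ∏ a ∈ I, f a := by rw [Finset.prod_congr rfl hone, Finset.prod_const_one, one_mul]
    _ ≤ ∏ _a ∈ I, (∫ h, w h ^ 2 ∂(haarProbability G)) / ((∫ g, w g ∂(haarProbability G)) * M ^ 1) :=
        Finset.prod_le_prod (fun a _ => hf0 a) hle
    _ = _ := Finset.prod_const _

end Summit.Ventures.LatticeQCDFlow.Theory2.Autoregressive

end
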